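import Literature.NumberTheory.Transcendental.BoxIntegralZetaValues
import Literature.NumberTheory.Transcendental.KZCalculus

/-!
# `NormalFormPrinciple` (stmt-KontsevichZagierPeriods-3869), line `SketchIdeator1` —
# the leaf `stub_boxRigidity` in dimension two, level one: the value of `[(0,1)², β/(1 − xy)]`

Pure proof file (stub `value_zetaTwoRep` of the dimension-two layer, lead seat c7; `--supports` the
crux). The box part of the level-one normal form `[(0,1)², β/(1 − xy)] + [pt, q]` represents
`β · ζ(2) = β · π²/6`: for an integral representation `B` of dimension `2`
(`Literature.NumberTheory.Transcendental.KZ.IntegralRep 2`) whose domain is the open unit box and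
whose integrand agrees with `x ↦ β/(1 − x₀x₁)` there,

  `B.value = ∫∫_{(0,1)²} β dx₀dx₁/(1 − x₀x₁) = β · π²/6`

(Beukers' double integral for `ζ(2)`, the tree's `box_integral_one_div_one_sub_mul_two`, after the
constant `β` is pulled out of the set integral).

Sources: M. Kontsevich, D. Zagier, *Periods* (2001), §1.1; F. Beukers, *A note on the
irrationality of ζ(2) and ζ(3)*, Bull. LMS 11 (1979). No definitions are introduced.
-/

noncomputable section

open MeasureTheory Set
open Literature.NumberTheory.Transcendental Literature.NumberTheory.Transcendental.KZ

namespace Summit.KontsevichZagierPeriods.HurwitzMicroSectors.NormalFormPrinciple.PiBox.LevelOne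

/-- **E (value of the level-one box part).** An integral representation of dimension `2` on the
open unit box `(0,1)²` with integrand `β/(1 − x₀x₁)` (`β ∈ ℚ`) represents `β · ζ(2) = β · π²/6`
(Beukers' double integral `∫∫_{(0,1)²} dx₀dx₁/(1 − x₀x₁) = π²/6`).
[cite: KontsevichZagier2001, §1.1] -/
theorem value_zetaTwoRep (β : ℚ) (B : IntegralRep 2)
    (hBd : B.domain = {x | ∀ i, x i ∈ Set.Ioo (0:ℝ) 1})
    (hBi : EqOn B.integrand (fun x => (β : ℝ) / (1 - x 0 * x 1)) B.domain) :
    B.value = (β : ℝ) * (Real.pi ^ 2 / 6) := by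
  rw [KZ.IntegralRep.value, setIntegral_congr_fun (KZ.IntegralRep.measurableSet_domain_holds B) hBi,
    hBd]
  simp_rw [div_eq_mul_one_div (β : ℝ)]
  rw [integral_const_mul, box_integral_one_div_one_sub_mul_two.2]

end Summit.KontsevichZagierPeriods.HurwitzMicroSectors.NormalFormPrinciple.PiBox.LevelOne
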